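import Mathlib
import HarnessLib

/-!
# Space-time mollification toolkit for `L^∞` solutions of scalar conservation laws

Topic `Literature/Analysis/PDE/SingleEntropy`. Proved real-analysis lemmas (no named facts) used
in the formalization of De Lellis–Otto–Westdickenberg, *Minimal entropy conditions for Burgers
equation*, Quart. Appl. Math. 62 (2004), Thm 2.3 / Cor 2.5
(`Literature.Analysis.PDE.deLellisOttoWestdickenberg_singleEntropy`):

* slice derivatives `deriv (fun t => φ (t, x)) t` versus `fderiv ℝ φ (t, x) (1, 0)`, and the
  passage from the pairing `∫_Ω (G₁ ∂ₜφ + G₂ ∂ₓφ)` of the named fact to a whole-plane pairing;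
* mollification `ρ.normed volume ⋆ g` of a bounded measurable `g : ℝ × ℝ → ℝ` by a normed bump
  `ρ : ContDiffBump (0 : ℝ × ℝ)`: integral formula, smoothness, derivative formula, `L^∞` bound,
  a.e. convergence as the radius shrinks (Lebesgue differentiation, from Mathlib);
* the reflected bump `z ↦ ρ.normed volume (p - z)` as an admissible test function, and the
  resulting POINTWISE identities for the mollifications of a distributional solution of
  `uₜ + f(u)ₓ = 0` (`mollify_conservationLaw`) and of a one-sided bound `uₓ ≤ C` in `𝒟'`
  (`fderiv_mollify_le_of_oneSided`).

All statements are standard real analysis. [folklore]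
-/

noncomputable section

open MeasureTheory Set Filter Metric ContinuousLinearMap
open scoped Topology Convolution

namespace Literature.Analysis.PDE.SingleEntropy


/-! ## Slice derivatives -/

/-- The `t`-slice derivative of a differentiable `φ : ℝ × ℝ → ℝ` is the Fréchet derivative in
direction `(1, 0)`. [folklore] -/
theorem hasDerivAt_slice_fst {φ : ℝ × ℝ → ℝ} {t x : ℝ} (h : DifferentiableAt ℝ φ (t, x)) :
    HasDerivAt (fun s => φ (s, x)) (fderiv ℝ φ (t, x) (1, 0)) t := by
  have h1 : HasDerivAt (fun s : ℝ => (s, x)) (1, 0) t :=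
    (hasDerivAt_id t).prodMk (hasDerivAt_const t x)
  exact h.hasFDerivAt.comp_hasDerivAt t h1

/-- The `x`-slice derivative of a differentiable `φ : ℝ × ℝ → ℝ` is the Fréchet derivative in
direction `(0, 1)`. [folklore] -/
theorem hasDerivAt_slice_snd {φ : ℝ × ℝ → ℝ} {t x : ℝ} (h : DifferentiableAt ℝ φ (t, x)) :
    HasDerivAt (fun y => φ (t, y)) (fderiv ℝ φ (t, x) (0, 1)) x := by
  have h1 : HasDerivAt (fun y : ℝ => (t, y)) (0, 1) x :=
    (hasDerivAt_const x t).prodMk (hasDerivAt_id x)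
  exact h.hasFDerivAt.comp_hasDerivAt x h1

/-- Slice derivative in `t` as a Fréchet derivative. [folklore] -/
theorem deriv_slice_fst {φ : ℝ × ℝ → ℝ} {p : ℝ × ℝ} (h : DifferentiableAt ℝ φ p) :
    deriv (fun s => φ (s, p.2)) p.1 = fderiv ℝ φ p (1, 0) :=
  (hasDerivAt_slice_fst (t := p.1) (x := p.2) h).deriv

/-- Slice derivative in `x` as a Fréchet derivative. [folklore] -/
theorem deriv_slice_snd {φ : ℝ × ℝ → ℝ} {p : ℝ × ℝ} (h : DifferentiableAt ℝ φ p) :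
    deriv (fun y => φ (p.1, y)) p.2 = fderiv ℝ φ p (0, 1) :=
  (hasDerivAt_slice_snd (t := p.1) (x := p.2) h).deriv

/-- Outside the topological support both slice derivatives vanish. [folklore] -/
theorem deriv_slice_fst_eq_zero_of_notMem_tsupport {φ : ℝ × ℝ → ℝ} {p : ℝ × ℝ}
    (hp : p ∉ tsupport φ) : deriv (fun s => φ (s, p.2)) p.1 = 0 := by
  have h0 : φ =ᶠ[𝓝 p] 0 := notMem_tsupport_iff_eventuallyEq.mp hp
  have hc : Tendsto (fun s : ℝ => (s, p.2)) (𝓝 p.1) (𝓝 p) := by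
    have : Continuous (fun s : ℝ => (s, p.2)) := by fun_prop
    simpa using this.tendsto p.1
  have h1 : (fun s => φ (s, p.2)) =ᶠ[𝓝 p.1] fun _ => 0 := hc.eventually h0
  rw [h1.deriv_eq]
  exact deriv_const p.1 0

/-- Outside the topological support both slice derivatives vanish. [folklore] -/
theorem deriv_slice_snd_eq_zero_of_notMem_tsupport {φ : ℝ × ℝ → ℝ} {p : ℝ × ℝ}
    (hp : p ∉ tsupport φ) : deriv (fun y => φ (p.1, y)) p.2 = 0 := by
  have h0 : φ =ᶠ[𝓝 p] 0 := notMem_tsupport_iff_eventuallyEq.mp hp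
  have hc : Tendsto (fun y : ℝ => (p.1, y)) (𝓝 p.2) (𝓝 p) := by
    have : Continuous (fun y : ℝ => (p.1, y)) := by fun_prop
    simpa using this.tendsto p.2
  have h1 : (fun y => φ (p.1, y)) =ᶠ[𝓝 p.2] fun _ => 0 := hc.eventually h0
  rw [h1.deriv_eq]
  exact deriv_const p.2 0

/-- A pairing `∫_Ω (G₁ ∂ₜφ + G₂ ∂ₓφ)` against a test function supported in `Ω` is the same
pairing over the whole plane. [folklore] -/
theorem setIntegral_pairing_eq_integral {Ω : Set (ℝ × ℝ)} {φ : ℝ × ℝ → ℝ}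
    (hφ : tsupport φ ⊆ Ω) (G₁ G₂ : ℝ × ℝ → ℝ) :
    ∫ p in Ω, (G₁ p * deriv (fun s => φ (s, p.2)) p.1 + G₂ p * deriv (fun y => φ (p.1, y)) p.2)
      = ∫ p, (G₁ p * deriv (fun s => φ (s, p.2)) p.1
          + G₂ p * deriv (fun y => φ (p.1, y)) p.2) := by
  apply setIntegral_eq_integral_of_forall_compl_eq_zero
  intro p hp
  have hp' : p ∉ tsupport φ := fun h => hp (hφ h)
  simp [deriv_slice_fst_eq_zero_of_notMem_tsupport hp',
    deriv_slice_snd_eq_zero_of_notMem_tsupport hp']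

/-- For a `C¹` test function the slice-derivative pairing is the Fréchet-derivative pairing.
[folklore] -/
theorem integral_pairing_eq_fderiv {φ : ℝ × ℝ → ℝ} (hφ : Differentiable ℝ φ)
    (G₁ G₂ : ℝ × ℝ → ℝ) :
    ∫ p, (G₁ p * deriv (fun s => φ (s, p.2)) p.1 + G₂ p * deriv (fun y => φ (p.1, y)) p.2)
      = ∫ p, (G₁ p * fderiv ℝ φ p (1, 0) + G₂ p * fderiv ℝ φ p (0, 1)) := by
  congr 1
  funext p
  rw [deriv_slice_fst (hφ p), deriv_slice_snd (hφ p)]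

/-! ## Bounded measurable functions -/

/-- A bounded measurable function on the plane is locally integrable. [folklore] -/
theorem locallyIntegrable_of_abs_le {g : ℝ × ℝ → ℝ} (hg : Measurable g) {M : ℝ}
    (hgM : ∀ z, |g z| ≤ M) : LocallyIntegrable g volume := by
  intro x
  refine ⟨closedBall x 1, closedBall_mem_nhds _ one_pos, ?_⟩
  refine IntegrableOn.of_bound measure_closedBall_lt_top hg.aestronglyMeasurable M
    (ae_of_all _ fun z => ?_)
  simpa [Real.norm_eq_abs] using hgM z

/-- A bounded measurable function times a continuous compactly supported one is integrable.
[folklore] -/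
theorem integrable_mul_of_abs_le {g : ℝ × ℝ → ℝ} (hg : Measurable g) {M : ℝ}
    (hgM : ∀ z, |g z| ≤ M) {k : ℝ × ℝ → ℝ} (hk : Continuous k) (hck : HasCompactSupport k) :
    Integrable (fun z => k z * g z) volume := by
  obtain ⟨C, hC⟩ := hck.exists_bound_of_continuous hk
  have hM : ∀ z, ‖k z * g z‖ ≤ |k z| * |M| := fun z => by
    rw [norm_mul, Real.norm_eq_abs, Real.norm_eq_abs]
    exact mul_le_mul_of_nonneg_left ((hgM z).trans (le_abs_self M)) (abs_nonneg _)
  refine Integrable.mono' ((hk.abs.integrable_of_hasCompactSupport hck.abs).mul_const |M|)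
    ((hk.measurable.mul hg).aestronglyMeasurable) (ae_of_all _ hM)

/-! ## Mollification by a normed bump -/

variable (ρ : ContDiffBump (0 : ℝ × ℝ))

/-- Integral formula for the mollification `ρ̄ ⋆ g`, `ρ̄ = ρ.normed`:
`(ρ̄ ⋆ g)(p) = ∫ ρ̄ (p - z) g(z) dz`. This is Mathlib's `MeasureTheory.convolution_lsmul_swap`
specialised to `ρ̄`; the name is kept for its users (`Potential`, `OleinikEntropySmooth`, …).
[folklore] -/
theorem mollify_apply (g : ℝ × ℝ → ℝ) (p : ℝ × ℝ) :
    (ρ.normed volume ⋆[lsmul ℝ ℝ, volume] g) p = ∫ z, ρ.normed volume (p - z) * g z :=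
  convolution_lsmul_swap

/-- The mollification of a bounded measurable function is smooth. [folklore] -/
theorem contDiff_mollify {g : ℝ × ℝ → ℝ} (hg : Measurable g) {M : ℝ} (hgM : ∀ z, |g z| ≤ M) :
    ContDiff ℝ (⊤ : ℕ∞) (ρ.normed volume ⋆[lsmul ℝ ℝ, volume] g) :=
  ρ.hasCompactSupport_normed.contDiff_convolution_left (lsmul ℝ ℝ) ρ.contDiff_normed
    (locallyIntegrable_of_abs_le hg hgM)

/-- The mollification of a function bounded by `M` is bounded by `M`. [folklore] -/
theorem abs_mollify_le {g : ℝ × ℝ → ℝ} {M : ℝ} (hgM : ∀ z, |g z| ≤ M) (p : ℝ × ℝ) : |(ρ.normed volume ⋆[lsmul ℝ ℝ, volume] g) p| ≤ M := by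
  rw [mollify_apply]
  have h1 : ∫ z, ρ.normed volume (p - z) = (1 : ℝ) := by
    rw [integral_sub_left_eq_self (fun z => ρ.normed volume z) volume p]
    exact ρ.integral_normed
  have hint : Integrable (fun z => ρ.normed volume (p - z)) volume := by
    have := ρ.integrable_normed (μ := volume)
    exact this.comp_sub_left p
  calc |∫ z, ρ.normed volume (p - z) * g z|
      ≤ ∫ z, |ρ.normed volume (p - z) * g z| := abs_integral_le_integral_abs
    _ ≤ ∫ z, ρ.normed volume (p - z) * M := by
        apply integral_mono_of_nonneg (ae_of_all _ fun z => abs_nonneg _) (hint.mul_const M)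
        refine ae_of_all _ fun z => ?_
        dsimp only
        rw [abs_mul, abs_of_nonneg (ρ.nonneg_normed _)]
        exact mul_le_mul_of_nonneg_left (hgM z) (ρ.nonneg_normed _)
    _ = M := by rw [integral_mul_const, h1, one_mul]

/-- The derivative of the normed bump vanishes outside the closed ball of radius `rOut`. [folklore] -/
theorem fderiv_normed_eq_zero {a : ℝ × ℝ} (ha : a ∉ closedBall (0 : ℝ × ℝ) ρ.rOut) :
    fderiv ℝ (ρ.normed volume) a = 0 := by
  by_contra h
  have h1 : a ∈ Function.support (fderiv ℝ (ρ.normed volume)) := h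
  have h2 := support_fderiv_subset ℝ h1
  rw [ρ.tsupport_normed_eq (μ := volume)] at h2
  exact ha h2

/-- Derivative of the mollification: `∂ᵥ(ρ̄ ⋆ g)(p) = ∫ ∂ᵥρ̄ (p - z) g(z) dz`. [folklore] -/
theorem fderiv_mollify_apply {g : ℝ × ℝ → ℝ} (hg : Measurable g) {M : ℝ}
    (hgM : ∀ z, |g z| ≤ M) (p v : ℝ × ℝ) :
    fderiv ℝ (ρ.normed volume ⋆[lsmul ℝ ℝ, volume] g) p v
      = ∫ z, fderiv ℝ (ρ.normed volume) (p - z) v * g z := by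
  have hli := locallyIntegrable_of_abs_le hg hgM
  have H := (ρ.hasCompactSupport_normed (μ := volume)).hasFDerivAt_convolution_left
    (lsmul ℝ ℝ) (ρ.contDiff_normed (n := 1)) hli p
  rw [H.fderiv, ← convolution_flip]
  have e : ((lsmul ℝ ℝ : ℝ →L[ℝ] ℝ →L[ℝ] ℝ).precompL (ℝ × ℝ)).flip
      = (lsmul ℝ ℝ : ℝ →L[ℝ] ℝ →L[ℝ] ℝ).flip.precompR (ℝ × ℝ) := by
    rw [ContinuousLinearMap.precompL, ContinuousLinearMap.flip_flip]
  rw [e, convolution_precompR_apply _ hli ((ρ.hasCompactSupport_normed (μ := volume)).fderiv ℝ)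
    ((ρ.contDiff_normed (n := 1)).continuous_fderiv one_ne_zero), convolution_def]
  simp only [flip_apply, lsmul_apply, smul_eq_mul]

/-- Lebesgue differentiation: mollifications by shrinking bumps (with `rOut ≤ 2 rIn`) converge
a.e. to the function. [folklore] -/
theorem ae_tendsto_mollify {ρs : ℕ → ContDiffBump (0 : ℝ × ℝ)}
    (hr : Tendsto (fun n => (ρs n).rOut) atTop (𝓝 0))
    (hr2 : ∀ n, (ρs n).rOut ≤ 2 * (ρs n).rIn)
    {g : ℝ × ℝ → ℝ} (hg : Measurable g) {M : ℝ} (hgM : ∀ z, |g z| ≤ M) :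
    ∀ᵐ p ∂(volume : Measure (ℝ × ℝ)),
      Tendsto (fun n => ((ρs n).normed volume ⋆[lsmul ℝ ℝ, volume] g) p) atTop (𝓝 (g p)) :=
  ContDiffBump.ae_convolution_tendsto_right_of_locallyIntegrable hr (Eventually.of_forall hr2)
    (locallyIntegrable_of_abs_le hg hgM)

/-! ## The reflected bump as a test function -/

/-- The reflected bump `z ↦ ρ̄ (p - z)` is smooth. [folklore] -/
theorem contDiff_reflect (p : ℝ × ℝ) :
    ContDiff ℝ (⊤ : ℕ∞) (fun z => ρ.normed volume (p - z)) :=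
  ρ.contDiff_normed.comp (contDiff_const.sub contDiff_id)

/-- The reflected bump is differentiable. [folklore] -/
theorem differentiable_reflect (p : ℝ × ℝ) :
    Differentiable ℝ (fun z => ρ.normed volume (p - z)) :=
  (contDiff_reflect ρ p).differentiable (by simp)

/-- The reflected bump vanishes outside `ball p rOut`. [folklore] -/
theorem reflect_eq_zero {p z : ℝ × ℝ} (hz : z ∉ ball p ρ.rOut) : ρ.normed volume (p - z) = 0 := by
  have : p - z ∉ Function.support (ρ.normed volume) := by
    rw [ρ.support_normed_eq]
    intro h
    apply hz
    rw [mem_ball_zero_iff] at h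
    rwa [mem_ball, dist_eq_norm, ← norm_sub_rev]
  simpa [Function.mem_support] using this

/-- The topological support of the reflected bump lies in `closedBall p rOut`. [folklore] -/
theorem tsupport_reflect_subset (p : ℝ × ℝ) :
    tsupport (fun z => ρ.normed volume (p - z)) ⊆ closedBall p ρ.rOut := by
  apply closure_minimal _ isClosed_closedBall
  intro z hz
  by_contra h
  exact hz (reflect_eq_zero ρ (fun h' => h (ball_subset_closedBall h')))

/-- The reflected bump has compact support. [folklore] -/
theorem hasCompactSupport_reflect (p : ℝ × ℝ) :
    HasCompactSupport (fun z => ρ.normed volume (p - z)) :=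
  HasCompactSupport.of_support_subset_isCompact (isCompact_closedBall p ρ.rOut)
    (subset_trans subset_closure (tsupport_reflect_subset ρ p))

/-- Derivative of the reflected bump. [folklore] -/
theorem fderiv_reflect_apply (p z v : ℝ × ℝ) :
    fderiv ℝ (fun z => ρ.normed volume (p - z)) z v = -(fderiv ℝ (ρ.normed volume) (p - z) v) := by
  have h1 : HasFDerivAt (fun z : ℝ × ℝ => p - z) (0 - ContinuousLinearMap.id ℝ (ℝ × ℝ)) z :=
    (hasFDerivAt_const p z).sub (hasFDerivAt_id z)
  have h2 : HasFDerivAt (ρ.normed volume) (fderiv ℝ (ρ.normed volume) (p - z)) (p - z) :=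
    ((ρ.contDiff_normed (n := 1)).differentiable one_ne_zero _).hasFDerivAt
  have h3 : HasFDerivAt (fun z => ρ.normed volume (p - z))
      ((fderiv ℝ (ρ.normed volume) (p - z)).comp (0 - ContinuousLinearMap.id ℝ (ℝ × ℝ))) z :=
    h2.comp z h1
  rw [h3.fderiv]
  simp

/-- `z ↦ ∂ᵥρ̄ (p - z)` is continuous. [folklore] -/
theorem continuous_fderiv_reflect (p v : ℝ × ℝ) :
    Continuous fun z => fderiv ℝ (ρ.normed volume) (p - z) v :=
  (((ρ.contDiff_normed (n := 1)).continuous_fderiv one_ne_zero).comp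
    (continuous_const.sub continuous_id)).clm_apply continuous_const

/-- `z ↦ ∂ᵥρ̄ (p - z)` has compact support. [folklore] -/
theorem hasCompactSupport_fderiv_reflect (p v : ℝ × ℝ) :
    HasCompactSupport fun z => fderiv ℝ (ρ.normed volume) (p - z) v := by
  apply HasCompactSupport.of_support_subset_isCompact (isCompact_closedBall p ρ.rOut)
  intro z hz
  by_contra h
  have : p - z ∉ closedBall (0 : ℝ × ℝ) ρ.rOut := by
    intro h'
    apply h
    rw [mem_closedBall_zero_iff] at h'
    rwa [mem_closedBall, dist_eq_norm, ← norm_sub_rev]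
  exact hz (by simp [fderiv_normed_eq_zero ρ this])

/-- A continuous function of a function bounded by `M` is bounded. [folklore] -/
theorem exists_abs_comp_le {u : ℝ × ℝ → ℝ} {M : ℝ} (huM : ∀ p, |u p| ≤ M) {f : ℝ → ℝ}
    (hf : Continuous f) : ∃ M', ∀ p, |f (u p)| ≤ M' := by
  obtain ⟨C, hC⟩ := (isCompact_Icc (a := -M) (b := M)).exists_bound_of_continuousOn
    hf.continuousOn
  exact ⟨C, fun p => by simpa [Real.norm_eq_abs] using hC (u p) (mem_Icc.mpr (abs_le.mp (huM p)))⟩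

/-! ## Pointwise consequences of distributional (in)equalities -/

/-- **Mollified conservation law.** If `uₜ + f(u)ₓ = 0` in `𝒟'(Ω)` then at every point `p`
with `closedBall p rOut ⊆ Ω` the mollifications satisfy `∂ₜ(ρ̄ ⋆ u) + ∂ₓ(ρ̄ ⋆ f(u)) = 0`
exactly. [folklore] -/
theorem mollify_conservationLaw {Ω : Set (ℝ × ℝ)} {u : ℝ × ℝ → ℝ} (hu : Measurable u) {M : ℝ}
    (huM : ∀ p, |u p| ≤ M) {f : ℝ → ℝ} (hf : Continuous f)
    (hws : ∀ φ : ℝ × ℝ → ℝ, ContDiff ℝ (⊤ : ℕ∞) φ → HasCompactSupport φ → tsupport φ ⊆ Ω →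
      ∫ p in Ω, (u p * deriv (fun t => φ (t, p.2)) p.1
        + f (u p) * deriv (fun x => φ (p.1, x)) p.2) = 0)
    {p : ℝ × ℝ} (hp : closedBall p ρ.rOut ⊆ Ω) :
    fderiv ℝ (ρ.normed volume ⋆[lsmul ℝ ℝ, volume] u) p (1, 0)
      + fderiv ℝ (ρ.normed volume ⋆[lsmul ℝ ℝ, volume] (fun z => f (u z))) p (0, 1) = 0 := by
  have hsub := (tsupport_reflect_subset ρ p).trans hp
  have h := hws _ (contDiff_reflect ρ p) (hasCompactSupport_reflect ρ p) hsub
  rw [setIntegral_pairing_eq_integral hsub,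
    integral_pairing_eq_fderiv (differentiable_reflect ρ p)] at h
  simp_rw [fderiv_reflect_apply] at h
  have hfu : Measurable fun z => f (u z) := hf.measurable.comp hu
  obtain ⟨M', hM'⟩ := exists_abs_comp_le huM hf
  rw [fderiv_mollify_apply ρ hu huM, fderiv_mollify_apply ρ hfu hM']
  have i1 : Integrable (fun z => fderiv ℝ (ρ.normed volume) (p - z) (1, 0) * u z) volume :=
    integrable_mul_of_abs_le hu huM (continuous_fderiv_reflect ρ p (1, 0))
      (hasCompactSupport_fderiv_reflect ρ p (1, 0))
  have i2 : Integrable (fun z => fderiv ℝ (ρ.normed volume) (p - z) (0, 1) * f (u z)) volume :=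
    integrable_mul_of_abs_le hfu hM' (continuous_fderiv_reflect ρ p (0, 1))
      (hasCompactSupport_fderiv_reflect ρ p (0, 1))
  have e : ∫ z, (u z * -(fderiv ℝ (ρ.normed volume) (p - z) (1, 0))
      + f (u z) * -(fderiv ℝ (ρ.normed volume) (p - z) (0, 1)))
      = -((∫ z, fderiv ℝ (ρ.normed volume) (p - z) (1, 0) * u z)
          + ∫ z, fderiv ℝ (ρ.normed volume) (p - z) (0, 1) * f (u z)) := by
    rw [← integral_add i1 i2, ← integral_neg]
    congr 1
    funext z
    ring
  rw [e] at h
  linarith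

/-- **Mollified one-sided bound.** If `uₓ ≤ C` in `𝒟'(V)` (tested against nonnegative smooth
functions supported in `V`) then `∂ₓ(ρ̄ ⋆ u)(p) ≤ C` at every `p` with `closedBall p rOut ⊆ V`.
[folklore] -/
theorem fderiv_mollify_le_of_oneSided {V : Set (ℝ × ℝ)} {u : ℝ × ℝ → ℝ} (hu : Measurable u)
    {M : ℝ} (huM : ∀ p, |u p| ≤ M) {C : ℝ}
    (hol : ∀ ψ : ℝ × ℝ → ℝ, ContDiff ℝ (⊤ : ℕ∞) ψ → HasCompactSupport ψ → tsupport ψ ⊆ V →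
      (∀ z, 0 ≤ ψ z) → -(C * ∫ z, ψ z) ≤ ∫ z, u z * fderiv ℝ ψ z (0, 1))
    {p : ℝ × ℝ} (hp : closedBall p ρ.rOut ⊆ V) :
    fderiv ℝ (ρ.normed volume ⋆[lsmul ℝ ℝ, volume] u) p (0, 1) ≤ C := by
  have hsub := (tsupport_reflect_subset ρ p).trans hp
  have h := hol _ (contDiff_reflect ρ p) (hasCompactSupport_reflect ρ p) hsub
    (fun z => ρ.nonneg_normed _)
  have h1 : ∫ z, ρ.normed volume (p - z) = (1 : ℝ) := by
    rw [integral_sub_left_eq_self (fun z => ρ.normed volume z) volume p]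
    exact ρ.integral_normed
  rw [h1, mul_one] at h
  simp_rw [fderiv_reflect_apply] at h
  rw [fderiv_mollify_apply ρ hu huM]
  have e : ∫ z, u z * -(fderiv ℝ (ρ.normed volume) (p - z) (0, 1))
      = -∫ z, fderiv ℝ (ρ.normed volume) (p - z) (0, 1) * u z := by
    rw [← integral_neg]
    congr 1
    funext z
    ring
  rw [e] at h
  linarith

end Literature.Analysis.PDE.SingleEntropy
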